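import Summits.RiemannHypothesis.RiemannHypothesis.Theses.WeilComb
import Summits.RiemannHypothesis.RiemannHypothesis.Theorems.WeilCombCombSubcriticalStubAutocorrelation
import Summits.RiemannHypothesis.RiemannHypothesis.Theorems.WeilCombCombShapeAdmissible
import Literature.NumberTheory.LFunctions.WeilExplicit
import Literature.NumberTheory.LFunctions.WeilMellinBounds
import Literature.NumberTheory.LFunctions.WeilArchimedeanMoments
import Literature.NumberTheory.LFunctions.WeilArchimedeanPositivityProofs

/-!
# Window norm identity for the fixed-shape comb
(crux `WeilComb.CombShapePositivity`, item stmt-RiemannHypothesis-11229, line `Sketch`; stub `stub_windowNorm`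
of the glued Theorem-B statement `stub_window`)

Notation: `φ₀(u) = expNegInvGlue (1 - u²)` (the route's fixed bump, a Weil test supported in `[-1, 1]`,
`weilComb_shapeBump_isWeilTest`, `weilComb_shapeBump_tsupport_subset`), `φ_ε(t) = ε⁻¹ φ₀(t/ε)`,
`ψ_ε = φ_ε ⋆ φ̃_ε` (`weilConv`/`weilReflect`), comb `g(x) = Σ_{1 ≤ m ≤ M} a_m φ_ε(x − log m)`.

**Statement.** For `ε > 0`, `M`, `a` with `2ε(M+1) ≤ 1`:
`‖g‖₂² = ε⁻¹ ‖φ₀‖₂² Σ_{m ≤ M} |a_m|²`.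

**Proof** (through the autocorrelation). `‖g‖₂² = (g ⋆ g̃)(0)` (`weilConv_weilReflect_apply_zero`), and by
the landed comb autocorrelation `WeilCombSubcritical.stub_autocorrelation`,
`(g ⋆ g̃)(0) = Σ_{m,m'} a_m conj(a_{m'}) ψ_ε(−(log m − log m'))`.  On the window, distinct positive integers
`m ≠ m' ≤ M` satisfy the strict Diophantine gap `|log m − log m'| > 1/(M+1) ≥ 2ε`, while
`tsupport ψ_ε ⊆ [−2ε, 2ε]`; so only the diagonal survives and `ψ_ε(0) = ‖φ_ε‖₂² = ε⁻¹ ‖φ₀‖₂²`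
(substitution `u = t/ε`).  The private toolkit is adapted from the exact-prime-window file
`WeilCombCombShapePositivityExactPrimeWindow.lean` (same line).
-/

noncomputable section

-- the sub-problem path RiemannHypothesis/RiemannHypothesis duplicates a namespace (D-0017)
set_option linter.dupNamespace false

open scoped BigOperators ComplexConjugate
open Complex MeasureTheory Set

namespace Summit.RiemannHypothesis.RiemannHypothesis.Theorems.WeilCombBohrFejer

open Literature.NumberTheory.LFunctions

/-! ### Private toolkit: the dilate `φ_ε` and the kernel `ψ_ε = φ_ε ⋆ φ̃_ε` -/

/-- `φ_ε = ε⁻¹ φ(·/ε)` is a Weil test function (`ε ≠ 0`). -/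
private theorem isWeilTest_dil_windowNorm {φ : ℝ → ℂ} {ε : ℝ} (hφ : IsWeilTest φ) (hε : ε ≠ 0) :
    IsWeilTest (fun t : ℝ => (ε : ℂ)⁻¹ * φ (t / ε)) := by
  -- adapted from `WeilCombBohrFejer.isWeilTest_dil_window` (private, ExactPrimeWindow file)
  have h1 : IsWeilTest (fun t : ℝ => φ (t / ε)) := by
    refine ⟨hφ.1.comp (contDiff_id.div_const ε), ?_⟩
    have e : (fun t : ℝ => φ (t / ε)) = φ ∘ (Homeomorph.mulRight₀ ε⁻¹ (inv_ne_zero hε)) := by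
      ext t
      simp [div_eq_mul_inv]
    rw [e]
    exact hφ.2.comp_homeomorph _
  exact h1.const_mul _

/-- `tsupport φ ⊆ [-1, 1]` gives `tsupport φ_ε ⊆ [-ε, ε]` (`ε > 0`). -/
private theorem tsupport_dil_subset_windowNorm {φ : ℝ → ℂ} {ε : ℝ}
    (hsupp : tsupport φ ⊆ Icc (-1) 1) (hε : 0 < ε) :
    tsupport (fun t : ℝ => (ε : ℂ)⁻¹ * φ (t / ε)) ⊆ Icc (-ε) ε := by
  -- adapted from `WeilCombBohrFejer.tsupport_dil_subset_window` (private, ExactPrimeWindow file)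
  refine closure_minimal ?_ isClosed_Icc
  intro t ht
  rw [Function.mem_support] at ht
  have hφ : φ (t / ε) ≠ 0 := fun h => ht (by simp [h])
  have hmem : t / ε ∈ Icc (-1 : ℝ) 1 := hsupp (subset_tsupport _ hφ)
  constructor
  · have h := hmem.1
    rw [le_div_iff₀ hε] at h
    linarith
  · have h := hmem.2
    rw [div_le_iff₀ hε] at h
    linarith

/-- `ψ_ε(s) = 0` for `|s| > 2ε`. -/
private theorem psi_eq_zero_windowNorm {φ : ℝ → ℂ} {ε : ℝ} (hφ : IsWeilTest φ)
    (hsupp : tsupport φ ⊆ Icc (-1) 1) (hε : 0 < ε) {s : ℝ} (hs : 2 * ε < |s|) :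
    weilConv (fun t : ℝ => (ε : ℂ)⁻¹ * φ (t / ε))
        (weilReflect (fun t : ℝ => (ε : ℂ)⁻¹ * φ (t / ε))) s = 0 := by
  -- adapted from `WeilCombBohrFejer.psi_eq_zero_window` (private, ExactPrimeWindow file)
  have hsub : tsupport (weilConv (fun t : ℝ => (ε : ℂ)⁻¹ * φ (t / ε))
      (weilReflect (fun t : ℝ => (ε : ℂ)⁻¹ * φ (t / ε)))) ⊆ Icc (-(2 * ε)) (2 * ε) :=
    tsupport_weilConv_weilReflect_subset (isWeilTest_dil_windowNorm hφ hε.ne').2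
      (tsupport_dil_subset_windowNorm hsupp hε)
  refine eq_zero_of_tsupport_subset hsub fun h => ?_
  have h1 := h.1
  have h2 := h.2
  have : |s| ≤ 2 * ε := abs_le.2 ⟨h1, h2⟩
  linarith

/-- `ψ_ε(0) = ‖φ_ε‖₂² = ε⁻¹ ‖φ‖₂²` (`ε > 0`; substitution `u = t/ε`). -/
private theorem psi_zero_windowNorm (φ : ℝ → ℂ) {ε : ℝ} (hε : 0 < ε) :
    weilConv (fun t : ℝ => (ε : ℂ)⁻¹ * φ (t / ε))
        (weilReflect (fun t : ℝ => (ε : ℂ)⁻¹ * φ (t / ε))) 0 = ((ε⁻¹ * weilNorm2Sq φ : ℝ) : ℂ) := by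
  -- adapted from `WeilCombBohrFejer.psi_zero_window` (private, ExactPrimeWindow file)
  rw [weilConv_weilReflect_apply_zero]
  congr 1
  show (∫ t : ℝ, ‖(ε : ℂ)⁻¹ * φ (t / ε)‖ ^ 2) = ε⁻¹ * weilNorm2Sq φ
  have e : (fun t : ℝ => ‖(ε : ℂ)⁻¹ * φ (t / ε)‖ ^ 2) = fun t => ε⁻¹ ^ 2 * ‖φ (t / ε)‖ ^ 2 := by
    funext t
    rw [norm_mul, norm_inv, Complex.norm_real, Real.norm_eq_abs, abs_of_pos hε, mul_pow]
  rw [e, integral_const_mul, Measure.integral_comp_div (fun t => ‖φ t‖ ^ 2) ε, abs_of_pos hε,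
    smul_eq_mul]
  unfold weilNorm2Sq
  rw [← mul_assoc, sq, mul_assoc ε⁻¹, inv_mul_cancel₀ hε.ne', mul_one]

/-! ### The Diophantine gap between logarithms of integers -/

/-- STRICT Diophantine gap: for positive integers `p < q`, `1/(p + 1) < log q − log p`
(`log q − log p ≥ log((p+1)/p) = −log(1 − 1/(p+1)) > 1/(p+1)` by `x + 1 < exp x` for `x ≠ 0`). -/
private theorem log_gap_windowNorm {p q : ℕ} (hp : 1 ≤ p) (hpq : p < q) :
    1 / ((p : ℝ) + 1) < Real.log q - Real.log p := by
  -- adapted from `WeilCombBohrFejer.log_gap_window` (private, ExactPrimeWindow file)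
  have hp0 : (0 : ℝ) < p := Nat.cast_pos.2 hp
  have hp1 : (0 : ℝ) < p + 1 := by linarith
  have hq : (p : ℝ) + 1 ≤ q := by exact_mod_cast Nat.succ_le_of_lt hpq
  have h1 : Real.log ((p : ℝ) + 1) ≤ Real.log q := Real.log_le_log hp1 hq
  have hy : (-(1 / ((p : ℝ) + 1))) ≠ 0 := by
    have : (0 : ℝ) < 1 / ((p : ℝ) + 1) := by positivity
    linarith
  have hexp := Real.add_one_lt_exp hy
  have hratio_pos : (0 : ℝ) < p / (p + 1) := div_pos hp0 hp1
  have hratio : (p : ℝ) / (p + 1) = -(1 / ((p : ℝ) + 1)) + 1 := by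
    field_simp
    ring
  have h2 : Real.log ((p : ℝ) / (p + 1)) < -(1 / ((p : ℝ) + 1)) := by
    rw [Real.log_lt_iff_lt_exp hratio_pos, hratio]
    exact hexp
  rw [Real.log_div hp0.ne' hp1.ne'] at h2
  linarith

/-- For distinct positive integers `p ≠ q` with `min(p, q) ≤ M`: `1/(M + 1) < |log p − log q|`. -/
private theorem abs_log_sub_log_windowNorm {p q M : ℕ} (hp : 1 ≤ p) (hq : 1 ≤ q) (hpq : p ≠ q)
    (hmin : p ≤ M ∨ q ≤ M) : 1 / ((M : ℝ) + 1) < |Real.log p - Real.log q| := by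
  -- adapted from `WeilCombBohrFejer.abs_log_sub_log_window` (private, ExactPrimeWindow file)
  rcases lt_or_gt_of_ne hpq with h | h
  · have hpM : p ≤ M := hmin.elim id fun hqM => h.le.trans hqM
    have hpM' : (p : ℝ) + 1 ≤ (M : ℝ) + 1 := by
      have : (p : ℝ) ≤ M := by exact_mod_cast hpM
      linarith
    have hg := log_gap_windowNorm hp h
    have hpos : (0 : ℝ) < 1 / ((p : ℝ) + 1) := by positivity
    rw [abs_sub_comm, abs_of_pos (hpos.trans hg)]
    exact (one_div_le_one_div_of_le (by positivity) hpM').trans_lt hg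
  · have hqM : q ≤ M := hmin.elim (fun hpM => h.le.trans hpM) id
    have hqM' : (q : ℝ) + 1 ≤ (M : ℝ) + 1 := by
      have : (q : ℝ) ≤ M := by exact_mod_cast hqM
      linarith
    have hg := log_gap_windowNorm hq h
    have hpos : (0 : ℝ) < 1 / ((q : ℝ) + 1) := by positivity
    rw [abs_of_pos (hpos.trans hg)]
    exact (one_div_le_one_div_of_le (by positivity) hqM').trans_lt hg

/-- On the window `2ε(M+1) ≤ 1`: `ψ_ε(−(log p − log q)) = 0` for distinct positive integers `p ≠ q ≤ M`
(the strict gap `|log p − log q| > 1/(M+1) ≥ 2ε` beats the support radius `2ε` of `ψ_ε`). -/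
private theorem psi_neg_log_sub_log_eq_zero_windowNorm {φ : ℝ → ℂ} {ε : ℝ} (hφ : IsWeilTest φ)
    (hsupp : tsupport φ ⊆ Icc (-1) 1) (hε : 0 < ε) {M : ℕ} (hw : 2 * ε * ((M : ℝ) + 1) ≤ 1)
    {p q : ℕ} (hp : 1 ≤ p) (hq : 1 ≤ q) (hpq : p ≠ q) (hqM : q ≤ M) :
    weilConv (fun t : ℝ => (ε : ℂ)⁻¹ * φ (t / ε))
        (weilReflect (fun t : ℝ => (ε : ℂ)⁻¹ * φ (t / ε))) (-(Real.log p - Real.log q)) = 0 := by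
  -- adapted from `WeilCombBohrFejer.psi_log_sub_log_eq_zero_window` (private, ExactPrimeWindow file)
  refine psi_eq_zero_windowNorm hφ hsupp hε (lt_of_le_of_lt ?_
    ((abs_log_sub_log_windowNorm hp hq hpq (Or.inr hqM)).trans_eq (abs_neg _).symm))
  have hMpos : (0 : ℝ) < (M : ℝ) + 1 := by positivity
  rw [le_div_iff₀ hMpos]
  linarith

/-! ### The window norm identity -/

/-- Window norm identity for a comb on an arbitrary Weil test `φ` supported in `[-1, 1]`:
for `ε > 0` and `2ε(M+1) ≤ 1`, `‖Σ_{m ≤ M} a_m φ_ε(· − log m)‖₂² = ε⁻¹ ‖φ‖₂² Σ_{m ≤ M} |a_m|²`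
(`‖g‖₂² = (g ⋆ g̃)(0)`, comb autocorrelation, off-diagonal vanishing of `ψ_ε`, `ψ_ε(0) = ε⁻¹‖φ‖₂²`). -/
private theorem weilNorm2Sq_comb_windowNorm {φ : ℝ → ℂ} (hφ : IsWeilTest φ)
    (hsupp : tsupport φ ⊆ Icc (-1) 1) {ε : ℝ} (hε : 0 < ε) (M : ℕ) (a : ℕ → ℂ)
    (hw : 2 * ε * ((M : ℝ) + 1) ≤ 1) :
    weilNorm2Sq (fun x : ℝ => ∑ m ∈ Finset.Icc 1 M, a m * ((ε : ℂ)⁻¹ * φ ((x - Real.log (m : ℝ)) / ε))) =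
      ε⁻¹ * weilNorm2Sq φ * ∑ m ∈ Finset.Icc 1 M, ‖a m‖ ^ 2 := by
  apply Complex.ofReal_injective
  have h1 := congrFun
    (Summit.RiemannHypothesis.RiemannHypothesis.Theorems.WeilCombSubcritical.stub_autocorrelation
      φ hφ ε hε M a) 0
  rw [weilConv_weilReflect_apply_zero] at h1
  refine h1.trans ?_
  simp only [weilTranslate, zero_sub]
  have hdiag : ∀ m ∈ Finset.Icc 1 M, ∑ m' ∈ Finset.Icc 1 M, a m * conj (a m') *
      weilConv (fun t : ℝ => (ε : ℂ)⁻¹ * φ (t / ε))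
        (weilReflect (fun t : ℝ => (ε : ℂ)⁻¹ * φ (t / ε))) (-(Real.log (m : ℝ) - Real.log (m' : ℝ))) =
      a m * conj (a m) * weilConv (fun t : ℝ => (ε : ℂ)⁻¹ * φ (t / ε))
        (weilReflect (fun t : ℝ => (ε : ℂ)⁻¹ * φ (t / ε))) 0 := by
    intro m hm
    rw [Finset.sum_eq_single_of_mem m hm]
    · rw [sub_self, neg_zero]
    · intro m' hm' hne
      rw [psi_neg_log_sub_log_eq_zero_windowNorm hφ hsupp hε hw (Finset.mem_Icc.1 hm).1
        (Finset.mem_Icc.1 hm').1 (Ne.symm hne) (Finset.mem_Icc.1 hm').2, mul_zero]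
  rw [Finset.sum_congr rfl hdiag, ← Finset.sum_mul, psi_zero_windowNorm φ hε]
  have e : ∑ m ∈ Finset.Icc 1 M, a m * conj (a m) = ((∑ m ∈ Finset.Icc 1 M, ‖a m‖ ^ 2 : ℝ) : ℂ) := by
    rw [Complex.ofReal_sum]
    refine Finset.sum_congr rfl fun m _ => ?_
    rw [Complex.mul_conj, Complex.normSq_eq_norm_sq]
  rw [e]
  push_cast
  ring

/-- **Stub W2 — window norm identity.** For `ε > 0`, `M`, `a` with `2ε(M+1) ≤ 1` the translates
`φ_ε(· − log m)`, `1 ≤ m ≤ M`, of the dilated fixed bump `φ_ε = ε⁻¹ φ₀(·/ε)`, `φ₀(u) = expNegInvGlue (1 − u²)`,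
have pairwise disjoint supports (`|log m − log m'| > 1/(M+1) ≥ 2ε`), so
`‖g‖₂² = Σ |a_m|² ‖φ_ε‖₂² = ε⁻¹ ‖φ₀‖₂² Σ |a_m|²` for the comb `g = Σ_{m ≤ M} a_m φ_ε(· − log m)`. [folklore] -/
theorem stub_windowNorm : ∀ ε : ℝ, 0 < ε → ∀ (M : ℕ) (a : ℕ → ℂ), 2 * ε * ((M : ℝ) + 1) ≤ 1 →
    weilNorm2Sq (fun x : ℝ => ∑ m ∈ Finset.Icc 1 M,
        a m * ((ε : ℂ)⁻¹ * ((expNegInvGlue (1 - ((x - Real.log (m : ℝ)) / ε) ^ 2) : ℝ) : ℂ))) =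
      ε⁻¹ * weilNorm2Sq (fun u : ℝ => ((expNegInvGlue (1 - u ^ 2) : ℝ) : ℂ)) *
        ∑ m ∈ Finset.Icc 1 M, ‖a m‖ ^ 2 := by
  intro ε hε M a hw
  exact weilNorm2Sq_comb_windowNorm
    Summit.RiemannHypothesis.RiemannHypothesis.Theorems.weilComb_shapeBump_isWeilTest
    Summit.RiemannHypothesis.RiemannHypothesis.Theorems.weilComb_shapeBump_tsupport_subset hε M a hw

end Summit.RiemannHypothesis.RiemannHypothesis.Theorems.WeilCombBohrFejer

end
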